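import Literature.Geometry.ComplexAnalytic.HolomorphicSplittingHadamard
import HarnessLib

/-!
# The holomorphic splitting lemma (Morse lemma with a holomorphic parameter), chart form

Layer `Literature/Geometry/ComplexAnalytic`; theorems only. Written by the prover seat `hodge-nonav-prover-Bx` (g16, cell
`hodge-nonav`) as brick B4a of the programme «A₃-TRACE» (crux K1-B of `Summits/HodgeConjecture/HodgeConjecture/Theses/SignSymmetricPowers.lean`,
stmt-HodgeConjecture-19716), sequel of `HolomorphicSplittingHadamard`.

**Theorem (AGZV I §9.6 "Morse lemma with parameters" / Ebeling Prop. 3.13, holomorphic).** Let `F` be holomorphic on the polydisc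
`‖z‖ < r` of `Fin (m + 2) → ℂ` (coordinates `w = Fin.init z`, parameter `u = z last`), vanishing on the axis `{w = 0}` together
with its `w`-partials, with `dF(0) = 0` and second derivative `L = d(dF)(0)` NON-DEGENERATE ON THE `w`-SPACE. Then there is an open
partial homeomorphism `Θ` of `Fin (m + 2) → ℂ` with `0 ∈ Θ.source ⊆ {‖z‖ < r}`, `Θ 0 = 0`, holomorphic, real `C^∞` with `C^∞`
inverse, PRESERVING THE PARAMETER (`(Θ z) last = z last`) and with `F z = Σᵢ (Θ z)ᵢ.castSucc²` on `Θ.source`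
(`exists_splittingChart_zero`).

Proof = the tree's holomorphic Morse lemma (`HolomorphicMorseLemma`, Hirsch's route) run in the `w`-variables with `u` carried
along: `F z = R_z(w, w)` (`exists_bilinForm_eq_rel`), `θ₂ z = P(R_z) w` with Hirsch's `P` (`exists_contDiffOn_bilinearComp_eq`),
`Ψ z = (θ₂ z, u)` has derivative `1` at `0` (inverse function theorem, `exists_openPartialHomeomorph_contDiffOn_symm`), and a linear
isometry `R_0 ≅ Σ zᵢ²` of the `w`-space finishes.

## References

* [ArnoldGuseinZadeVarchenko1985] V. I. Arnold, S. M. Gusein-Zade, A. N. Varchenko, *Singularities of Differentiable Maps* I,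
  §9.6 (Morse lemma with parameters), §11.1.
* [Ebeling2007] W. Ebeling, *Functions of Several Complex Variables and Their Singularities*, Prop. 3.12–3.13.
* [Milnor1963] J. Milnor, *Morse theory*, Lemma 2.2.
* [HirschDT1976] M. W. Hirsch, *Differential Topology*, Ch. 6 §1.
-/

noncomputable section

open Set Function Filter Module Metric
open scoped Topology ContDiff

set_option maxSynthPendingDepth 2

namespace Literature.Geometry.ComplexAnalytic

namespace HolomorphicSplitting

variable {m : ℕ}

/-- The sum-of-squares quadratic form on `Fin k → ℂ` is non-degenerate. [folklore] -/
private theorem separatingLeft_sumSq {k : ℕ} :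
    (QuadraticMap.associated (R := ℂ) (QuadraticMap.weightedSumSquares ℂ (1 : Fin k → ℂ))).SeparatingLeft := by
  classical
  intro u hu
  funext i
  have h := hu (Pi.single i 1)
  rw [QuadraticMap.associated_apply] at h
  simp only [QuadraticMap.weightedSumSquares_apply, Pi.add_apply, Pi.one_apply, one_smul] at h
  have hsum : ∀ j : Fin k, (u j + (Pi.single i (1 : ℂ) : Fin k → ℂ) j) * (u j + (Pi.single i (1 : ℂ) : Fin k → ℂ) j)
      = u j * u j + ((Pi.single i (1 : ℂ) : Fin k → ℂ) j * (Pi.single i (1 : ℂ) : Fin k → ℂ) j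
        + 2 * (u j * (Pi.single i (1 : ℂ) : Fin k → ℂ) j)) := fun j => by ring
  simp_rw [hsum, Finset.sum_add_distrib, ← Finset.mul_sum] at h
  have h2 : ∑ j : Fin k, u j * (Pi.single i (1 : ℂ) : Fin k → ℂ) j = u i := by
    simp [Pi.single_apply]
  rw [h2] at h
  have h3 : (⅟ (2 : ℂ)) • (2 * u i) = 0 := by
    have e1 : ∑ x : Fin k, u x * u x + (∑ x : Fin k, (Pi.single i (1 : ℂ) : Fin k → ℂ) x *
        (Pi.single i (1 : ℂ) : Fin k → ℂ) x + 2 * u i) - ∑ x : Fin k, u x * u x -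
        ∑ x : Fin k, (Pi.single i (1 : ℂ) : Fin k → ℂ) x * (Pi.single i (1 : ℂ) : Fin k → ℂ) x = 2 * u i := by ring
    rw [e1] at h
    exact h
  rw [smul_eq_mul, ← mul_assoc, invOf_mul_self, one_mul] at h3
  simpa using h3

/-- `Fin.snoc` is additive in both arguments. [folklore] -/
private theorem snoc_add' (u u' : Fin (m + 1) → ℂ) (x x' : ℂ) :
    (Fin.snoc (u + u') (x + x') : Fin (m + 2) → ℂ) = Fin.snoc u x + Fin.snoc u' x' := by
  funext k
  refine Fin.lastCases ?_ (fun j => ?_) k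
  · simp [Fin.snoc_last]
  · simp [Fin.snoc_castSucc]

/-- `Fin.snoc` is homogeneous in both arguments. [folklore] -/
private theorem snoc_smul' (c : ℂ) (u : Fin (m + 1) → ℂ) (x : ℂ) :
    (Fin.snoc (c • u) (c * x) : Fin (m + 2) → ℂ) = c • Fin.snoc u x := by
  funext k
  refine Fin.lastCases ?_ (fun j => ?_) k
  · simp [Fin.snoc_last]
  · simp [Fin.snoc_castSucc]

/-- **The holomorphic splitting lemma at the origin, chart form** (module docstring).
[cite: ArnoldGuseinZadeVarchenko1985, §9.6] [cite: Ebeling2007, Prop. 3.13] [cite: Milnor1963, Lemma 2.2] -/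
theorem exists_splittingChart_zero {r : ℝ} (hr : 0 < r) {F : (Fin (m + 2) → ℂ) → ℂ} (hF : DifferentiableOn ℂ F (ball 0 r))
    (hax : ∀ z ∈ ball (0 : Fin (m + 2) → ℂ) r, F (Fin.snoc (0 : Fin (m + 1) → ℂ) (z (Fin.last (m + 1)))) = 0)
    (hcrit : ∀ z ∈ ball (0 : Fin (m + 2) → ℂ) r, ∀ i : Fin (m + 1),
      fderiv ℂ F (Fin.snoc (0 : Fin (m + 1) → ℂ) (z (Fin.last (m + 1)))) (Pi.single i.castSucc 1) = 0)
    (h1 : fderiv ℂ F 0 = 0) {L : (Fin (m + 2) → ℂ) →L[ℂ] (Fin (m + 2) → ℂ) →L[ℂ] ℂ} (h2 : HasFDerivAt (fderiv ℂ F) L 0)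
    (hL : ∀ u : Fin (m + 1) → ℂ, (∀ v : Fin (m + 1) → ℂ, L (Fin.snoc u 0) (Fin.snoc v 0) = 0) → u = 0) :
    ∃ Θ : OpenPartialHomeomorph (Fin (m + 2) → ℂ) (Fin (m + 2) → ℂ),
      (0 : Fin (m + 2) → ℂ) ∈ Θ.source ∧ Θ 0 = 0 ∧ Θ.source ⊆ ball 0 r ∧
      DifferentiableOn ℂ Θ Θ.source ∧ ContDiffOn ℝ ∞ Θ Θ.source ∧ ContDiffOn ℝ ∞ Θ.symm Θ.target ∧
      (∀ z ∈ Θ.source, Θ z (Fin.last (m + 1)) = z (Fin.last (m + 1))) ∧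
      ∀ z ∈ Θ.source, F z = ∑ i : Fin (m + 1), (Θ z i.castSucc) ^ 2 := by
  classical
  obtain ⟨R, hRd, hRsymm, hFR, hLR⟩ := exists_bilinForm_eq_rel hr hF hax hcrit h1 h2
  set H₀ := R 0 with hH₀
  have hH₀symm : ∀ u v, H₀ u v = H₀ v u := hRsymm 0
  have hH₀nd : ∀ u, (∀ v, H₀ u v = 0) → u = 0 := by
    intro u hu
    refine hL u fun v => ?_
    rw [hLR, hu v, mul_zero]
  obtain ⟨N, P, hNo, hH₀N, hPs, hPH₀, hPid⟩ := HolomorphicMorse.exists_contDiffOn_bilinearComp_eq H₀ hH₀symm hH₀nd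
  -- coordinate maps
  let initL : (Fin (m + 2) → ℂ) →L[ℂ] (Fin (m + 1) → ℂ) :=
    ContinuousLinearMap.pi fun j : Fin (m + 1) => ContinuousLinearMap.proj (R := ℂ) (φ := fun _ : Fin (m + 2) => ℂ) j.castSucc
  have hinitL : ∀ z, initL z = Fin.init z := fun z => rfl
  let J : (Fin (m + 1) → ℂ) →L[ℂ] (Fin (m + 2) → ℂ) :=
    ContinuousLinearMap.pi (Fin.snoc (α := fun _ : Fin (m + 2) => (Fin (m + 1) → ℂ) →L[ℂ] ℂ)
      (fun j : Fin (m + 1) => ContinuousLinearMap.proj (R := ℂ) (φ := fun _ : Fin (m + 1) => ℂ) j) 0)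
  have hJ : ∀ w, J w = Fin.snoc w 0 := by
    intro w
    funext k
    refine Fin.lastCases ?_ (fun j => ?_) k
    · simp [J, Fin.snoc_last]
    · simp [J, Fin.snoc_castSucc]
  let K : (Fin (m + 2) → ℂ) →L[ℂ] (Fin (m + 2) → ℂ) :=
    ContinuousLinearMap.pi (Fin.snoc (α := fun _ : Fin (m + 2) => (Fin (m + 2) → ℂ) →L[ℂ] ℂ)
      (fun _ : Fin (m + 1) => (0 : (Fin (m + 2) → ℂ) →L[ℂ] ℂ))
      (ContinuousLinearMap.proj (R := ℂ) (φ := fun _ : Fin (m + 2) => ℂ) (Fin.last (m + 1))))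
  have hK : ∀ z, K z = Fin.snoc (0 : Fin (m + 1) → ℂ) (z (Fin.last (m + 1))) := by
    intro z
    funext k
    refine Fin.lastCases ?_ (fun j => ?_) k
    · simp [K, Fin.snoc_last]
    · simp [K, Fin.snoc_castSucc]
  have hJK : ∀ z : Fin (m + 2) → ℂ, J (Fin.init z) + K z = z := by
    intro z
    rw [hJ, hK]
    funext k
    refine Fin.lastCases ?_ (fun j => ?_) k
    · simp [Fin.snoc_last]
    · simp [Fin.snoc_castSucc, Fin.init]
  -- the domain `U₁ = ball ∩ R⁻¹ N` and the map `Ψ z = (P (R z) (init z), z last)`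
  set U₁ : Set (Fin (m + 2) → ℂ) := ball 0 r ∩ R ⁻¹' N with hU₁
  have hU₁o : IsOpen U₁ := hRd.continuousOn.isOpen_inter_preimage isOpen_ball hNo
  have h0U₁ : (0 : Fin (m + 2) → ℂ) ∈ U₁ := ⟨mem_ball_self hr, by rw [mem_preimage, ← hH₀]; exact hH₀N⟩
  set θ₂ : (Fin (m + 2) → ℂ) → (Fin (m + 1) → ℂ) := fun z => P (R z) (Fin.init z) with hθ₂
  set Ψ : (Fin (m + 2) → ℂ) → (Fin (m + 2) → ℂ) := fun z => Fin.snoc (θ₂ z) (z (Fin.last (m + 1))) with hΨ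
  have hPRd : DifferentiableOn ℂ (fun z => P (R z)) U₁ :=
    (hPs.differentiableOn (by simp)).comp (hRd.mono inter_subset_left) fun x hx => hx.2
  have hθ₂d : DifferentiableOn ℂ θ₂ U₁ := hPRd.clm_apply (initL.differentiable.differentiableOn.congr fun z _ => rfl)
  have hΨeq : ∀ z, Ψ z = J (θ₂ z) + K z := fun z => by rw [hJ, hK, hΨ]; funext k; refine Fin.lastCases ?_ (fun j => ?_) k <;> simp
  have hΨd : DifferentiableOn ℂ Ψ U₁ := by
    have : DifferentiableOn ℂ (fun z => J (θ₂ z) + K z) U₁ :=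
      (J.differentiable.comp_differentiableOn hθ₂d).add K.differentiable.differentiableOn
    exact this.congr fun z _ => hΨeq z
  have hinit0 : Fin.init (0 : Fin (m + 2) → ℂ) = 0 := rfl
  have hθ₂0 : θ₂ 0 = 0 := by
    show P (R 0) (Fin.init (0 : Fin (m + 2) → ℂ)) = 0
    rw [hinit0, map_zero]
  have hΨ0 : Ψ 0 = 0 := by
    rw [hΨeq, hθ₂0, map_zero, map_zero, add_zero]
  have hΨlast : ∀ z, Ψ z (Fin.last (m + 1)) = z (Fin.last (m + 1)) := fun z => by
    simp only [hΨ, Fin.snoc_last]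
  have hΨcs : ∀ z (i : Fin (m + 1)), Ψ z i.castSucc = θ₂ z i := fun z i => by
    simp only [hΨ, Fin.snoc_castSucc]
  -- derivative of `Ψ` at `0` is the identity
  have hΨderiv : HasFDerivAt Ψ ((ContinuousLinearEquiv.refl ℂ (Fin (m + 2) → ℂ) :
      (Fin (m + 2) → ℂ) ≃L[ℂ] (Fin (m + 2) → ℂ)) : (Fin (m + 2) → ℂ) →L[ℂ] (Fin (m + 2) → ℂ)) 0 := by
    have hc : HasFDerivAt (fun z => P (R z)) (fderiv ℂ (fun z => P (R z)) 0) 0 :=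
      (hPRd.differentiableAt (hU₁o.mem_nhds h0U₁)).hasFDerivAt
    have hθ : HasFDerivAt θ₂ initL 0 := by
      have h := hc.clm_apply initL.hasFDerivAt
      refine h.congr_fderiv ?_
      ext v i
      simp [← hH₀, hPH₀, hinitL, hinit0]
    have hΨ' : HasFDerivAt (fun z => J (θ₂ z) + K z) (J.comp initL + K) 0 :=
      (J.hasFDerivAt.comp 0 hθ).add K.hasFDerivAt
    have hΨ'' : HasFDerivAt Ψ (J.comp initL + K) 0 := hΨ'.congr_of_eventuallyEq (Eventually.of_forall fun z => hΨeq z)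
    refine hΨ''.congr_fderiv ?_
    ext v i
    rw [add_apply, ContinuousLinearMap.comp_apply]
    exact congrFun (hJK v) i
  have hΨcd : ContDiffOn ℂ ∞ Ψ U₁ :=
    (Literature.Analysis.Complex.SCV.analyticOnNhd_of_differentiableOn hΨd hU₁o).contDiffOn_of_completeSpace
  obtain ⟨G, hGΨ, h0G, hGU₁, hGcd, hGsymm, -⟩ :=
    HolomorphicMorse.exists_openPartialHomeomorph_contDiffOn_symm hU₁o h0U₁ (m := ∞) (by simp) hΨcd _ hΨderiv
  -- `F = H₀ (θ₂ ·) (θ₂ ·)` on `U₁`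
  have hFθ : ∀ z ∈ U₁, F z = H₀ (θ₂ z) (θ₂ z) := by
    intro z hz
    rw [hFR z hz.1, hθ₂]
    exact (hPid (R z) hz.2 (hRsymm z) _ _).symm
  -- the linear isometry `H₀ ≅ Σ zᵢ²` of the `w`-space
  let B₀ : LinearMap.BilinForm ℂ (Fin (m + 1) → ℂ) :=
    (ContinuousLinearMap.coeLM ℂ).comp (H₀ : (Fin (m + 1) → ℂ) →ₗ[ℂ] ((Fin (m + 1) → ℂ) →L[ℂ] ℂ))
  have hB₀ : ∀ u v, B₀ u v = H₀ u v := fun u v => rfl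
  let Q₁ : QuadraticForm ℂ (Fin (m + 1) → ℂ) := B₀.toQuadraticMap
  have hQ₁ : ∀ u, Q₁ u = H₀ u u := fun u => rfl
  have hQ₁nd : (QuadraticMap.associated (R := ℂ) Q₁).SeparatingLeft := by
    have hassoc : QuadraticMap.associated (R := ℂ) Q₁ = B₀ :=
      QuadraticMap.associated_left_inverse (S := ℂ) (B₁ := B₀) (fun u v => by rw [hB₀, hB₀, hH₀symm])
    rw [hassoc]
    intro u hu
    exact hH₀nd u fun v => by rw [← hB₀]; exact hu v
  obtain ⟨eQ⟩ := QuadraticForm.equivalent_of_isAlgClosed Q₁ (QuadraticMap.weightedSumSquares ℂ (1 : Fin (m + 1) → ℂ)) hQ₁nd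
    separatingLeft_sumSq
  have heQ : ∀ u : Fin (m + 1) → ℂ, ∑ i, (eQ u i) ^ 2 = H₀ u u := by
    intro u
    have h := eQ.map_app u
    rw [QuadraticMap.weightedSumSquares_apply] at h
    rw [← hQ₁, ← h]
    exact Finset.sum_congr rfl fun i _ => by simp [sq]
  -- the linear automorphism `Φ' z = (eQ (init z), z last)` of `Fin (m + 2) → ℂ`
  let Φℓ : (Fin (m + 2) → ℂ) ≃ₗ[ℂ] (Fin (m + 2) → ℂ) :=
    { toFun := fun z => Fin.snoc (eQ.toLinearEquiv (Fin.init z)) (z (Fin.last (m + 1)))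
      invFun := fun z => Fin.snoc (eQ.toLinearEquiv.symm (Fin.init z)) (z (Fin.last (m + 1)))
      map_add' := fun z z' => by
        rw [← snoc_add', ← map_add]
        rfl
      map_smul' := fun c z => by
        rw [RingHom.id_apply, ← snoc_smul', ← map_smul]
        rfl
      left_inv := fun z => by
        simp only [Fin.init_snoc, Fin.snoc_last, LinearEquiv.symm_apply_apply]
        exact Fin.snoc_init_self z
      right_inv := fun z => by
        simp only [Fin.init_snoc, Fin.snoc_last, LinearEquiv.apply_symm_apply]
        exact Fin.snoc_init_self z }
  let Φ' : (Fin (m + 2) → ℂ) ≃L[ℂ] (Fin (m + 2) → ℂ) := Φℓ.toContinuousLinearEquiv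
  have hΦ' : ∀ z, Φ' z = Fin.snoc (eQ (Fin.init z)) (z (Fin.last (m + 1))) := fun z => rfl
  -- the chart
  refine ⟨G.transHomeomorph Φ'.toHomeomorph, ?_, ?_, ?_, ?_, ?_, ?_, ?_, ?_⟩
  · simpa using h0G
  · show Φ' (G 0) = 0
    rw [hGΨ, hΨ0, map_zero]
  · intro x hx
    exact (hGU₁ (by simpa using hx)).1
  · have : DifferentiableOn ℂ (⇑Φ' ∘ ⇑G) G.source := Φ'.differentiable.comp_differentiableOn (hGΨ ▸ hΨd.mono hGU₁)
    simpa [OpenPartialHomeomorph.transHomeomorph] using this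
  · have : ContDiffOn ℂ ∞ (⇑Φ' ∘ ⇑G) G.source := Φ'.contDiff.comp_contDiffOn hGcd
    simpa [OpenPartialHomeomorph.transHomeomorph] using this.restrict_scalars ℝ
  · have htgt : (G.transHomeomorph Φ'.toHomeomorph).target = Φ'.toHomeomorph.symm ⁻¹' G.target := by
      simp [OpenPartialHomeomorph.transHomeomorph]
    have hsymm : ∀ z, (G.transHomeomorph Φ'.toHomeomorph).symm z = G.symm (Φ'.symm z) := fun z => rfl
    rw [htgt]
    have h : ContDiffOn ℂ ∞ (fun z => G.symm (Φ'.symm z)) (Φ'.toHomeomorph.symm ⁻¹' G.target) :=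
      hGsymm.comp Φ'.symm.contDiff.contDiffOn fun z hz => hz
    exact (h.restrict_scalars ℝ).congr fun z _ => hsymm z
  · intro z _
    show Φ' (G z) (Fin.last (m + 1)) = z (Fin.last (m + 1))
    rw [hΦ', Fin.snoc_last, hGΨ, hΨlast]
  · intro z hz
    have hz' : z ∈ G.source := by simpa using hz
    show F z = ∑ i : Fin (m + 1), (Φ' (G z) i.castSucc) ^ 2
    have hcs : ∀ i : Fin (m + 1), Φ' (G z) i.castSucc = eQ (θ₂ z) i := fun i => by
      rw [hΦ', Fin.snoc_castSucc, hGΨ]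
      have hinitΨ : Fin.init (Ψ z) = θ₂ z := funext fun j => hΨcs z j
      rw [hinitΨ]
    simp_rw [hcs]
    rw [heQ]
    exact hFθ z (hGU₁ hz')

end HolomorphicSplitting

end Literature.Geometry.ComplexAnalytic

end
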